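import Summits.AtomisticToContinuum.Crystallization.Theorems.ReggeStarCoercivityDefectFreeCrystallizesSiteColumnLJ
import Summits.AtomisticToContinuum.Crystallization.Theorems.ChessboardParticlePlanesPeriodicWindowsShapeStationarity2
import Summits.AtomisticToContinuum.Crystallization.Theorems.ChargedEnergyGap.Negative.BlocksBound

/-!
# The stacking lock (stub `stub_stackingLock` of line `registered`, crux
# `PerronTransitivity.UniformBindingRigidity`, stmt-AtomisticToContinuum-15099)

**Theorem** (`stub_stackingLock`).  Let `X = (A · + v) '' barlowStacking a h s` be a rigid image of the
Barlow stacking of a Hägg word `s`, with `(a, h)` in item 3063's registry box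
`47/50 ≤ a ≤ 1`, `39/50·a ≤ h ≤ 17/20·a`.  If every site of `X` is uniformly `2E*`-bound,
`∑'_{q ∈ X, q ≠ p} V_LJ(dist p q) ≤ 2E*`, `E* = ⨅_Q e_LJ(Q)` over periodic configurations, then the
word alternates: `s (m + 1) = -s m` for every `m` (ABAB… = hcp).

**Proof** (assembly of landed pieces).  Fix `m` and the site `p = A (barlowPos a h s m 0 0) + v ∈ X`.
* The site sum at `p` is `2 · barlowSiteEnergy V_LJ a h s m`: translate by `−v` (`Equiv.tsum_eq`,
  `dist_add_right`) and apply `PeriodicWindowsSketch.shp_site_tsum_eq` (with the summable index family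
  `PeriodicWindowsSketch.shp_summable_lennardJones_index` and `lennardJones_zero`).
* `E* ≤ e(hcp a h)` (`ChargedEnergyGapNegative.eStar_le`) and `e(hcp a h) = hcpE a h`
  (`ExcessDecayLiouvilleCoarseGrains.hcpEnergySeries_of_eq`, third clause); hence
  `barlowSiteEnergy V_LJ a h s m ≤ hcpE a h`.
* The site-energy column `PalmGoodLaw.SiteColumnLJ.stub_siteColumnLJ`:
  `hcpE a h + ½ (J₃ − J₂)([s (m+1) = s m] + [s (m−1) = s (m−2)]) ≤ barlowSiteEnergy V_LJ a h s m` with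
  `J₃ − J₂ > 0`, so `s (m + 1) ≠ s m`, i.e. `s (m + 1) = -s m` for a `±1` word.

All `[folklore]`.
-/

noncomputable section

namespace Summit.AtomisticToContinuum.Crystallization.Theorems.PerronTransitivityUniformBindingRigidity

open Literature.MathematicalPhysics.StatisticalMechanics
open Summit.AtomisticToContinuum.Crystallization.Theorems.PalmUnimodularRigidity.LayeredLawsSelectHcp
  (hcpE hcpQ)
open Summit.AtomisticToContinuum.Crystallization.Theorems.ExcessDecayLiouvilleCoarseGrains
  (hcpEnergySeries_of_eq)

/-! ## The site sum of a translated rigid image -/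

/-- **The site sum of a rigid image `(A · + v) '' barlowStacking a h s` is twice `barlowSiteEnergy`.**
For `a, h > 0`, a linear isometry equivalence `A`, a translation `v` and the base point of layer `m`:
`∑'_{q ∈ X, q ≠ p} V_LJ(dist p q) = 2 · barlowSiteEnergy V_LJ a h s m`, `p = A (barlowPos a h s m 0 0) + v`
(translate by `−v`, then `PeriodicWindowsSketch.shp_site_tsum_eq`). [folklore] -/
theorem site_tsum_translate_eq {a h : ℝ} (ha : 0 < a) (hh : 0 < h) (s : ℤ → ℤ)
    (A : EuclideanSpace ℝ (Fin 3) ≃ₗᵢ[ℝ] EuclideanSpace ℝ (Fin 3)) (v : EuclideanSpace ℝ (Fin 3))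
    (m : ℤ) :
    ∑' q : {q : EuclideanSpace ℝ (Fin 3) //
        q ∈ (fun z => A z + v) '' barlowStacking a h s ∧ q ≠ A (barlowPos a h s m 0 0) + v},
        lennardJones (dist (A (barlowPos a h s m 0 0) + v) q.1) =
      2 * barlowSiteEnergy lennardJones a h s m := by
  have hG : Summable fun t : ℤ × ℤ × ℤ =>
      lennardJones (dist (barlowPos a h s m 0 0) (barlowPos a h s t.1 t.2.1 t.2.2)) :=
    PeriodicWindowsSketch.shp_summable_lennardJones_index ha hh s (m, 0, 0)
  have key : ∑' q : {q : EuclideanSpace ℝ (Fin 3) //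
      q ∈ A '' barlowStacking a h s ∧ q ≠ A (barlowPos a h s m 0 0)},
        lennardJones (dist (A (barlowPos a h s m 0 0)) q.1) =
      2 * barlowSiteEnergy lennardJones a h s m :=
    PeriodicWindowsSketch.shp_site_tsum_eq ha hh s A.toLinearIsometry lennardJones lennardJones_zero
      m 0 0 hG
  rw [← key]
  -- translate by `-v`
  set x₀ : EuclideanSpace ℝ (Fin 3) := barlowPos a h s m 0 0 with hx₀
  have hiff : ∀ q : EuclideanSpace ℝ (Fin 3),
      (q ∈ A '' barlowStacking a h s ∧ q ≠ A x₀) ↔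
        (Equiv.addRight v q ∈ (fun z => A z + v) '' barlowStacking a h s ∧
          Equiv.addRight v q ≠ A x₀ + v) := by
    intro q
    simp only [Equiv.coe_addRight, Set.mem_image, ne_eq, add_left_inj]
  rw [← Equiv.tsum_eq (Equiv.subtypeEquiv (Equiv.addRight v) hiff)]
  refine tsum_congr fun q => ?_
  simp only [Equiv.subtypeEquiv_apply, Equiv.coe_addRight]
  rw [dist_add_right]

/-! ## The hcp level bounds `E*` -/

/-- `⨅_Q e_LJ(Q) ≤ hcpE a h` for `a, h > 0`: `E* ≤ e(hcp a h)` (`eStar_le`) and `e(hcp a h) = hcpE a h`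
(`hcpEnergySeries_of_eq`). [folklore] -/
theorem iInf_le_hcpE {a h : ℝ} (ha : 0 < a) (hh : 0 < h) :
    (⨅ Q : PeriodicConfiguration 3, Q.energyPerParticle lennardJones) ≤ hcpE a h := by
  have hE : hcpE a h = (hcpPeriodicConfiguration ha.ne' hh.ne').energyPerParticle lennardJones :=
    ((hcpEnergySeries_of_eq a h ha.ne' hh.ne' hcpQ rfl).2.2).symm
  rw [hE]
  exact ChargedEnergyGapNegative.eStar_le _

/-! ## The stub -/

/-- **Stub `stub_stackingLock` — the stacking lock.**  On a rigid image `(A · + v) '' barlowStacking a h s`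
of the Barlow stacking of a Hägg word `s`, `(a, h)` in the registry box `47/50 ≤ a ≤ 1`,
`39/50·a ≤ h ≤ 17/20·a`, uniform `2E*`-binding of every site forces the word to alternate,
`s (m + 1) = -s m` for all `m`: the site sum at `A (barlowPos a h s m 0 0) + v` is
`2 · barlowSiteEnergy V_LJ a h s m ≤ 2E* ≤ 2 hcpE a h`, and the site-energy column
(`stub_siteColumnLJ`, gap `J₃ − J₂ > 0`) then excludes `s (m + 1) = s m`. [folklore] -/
theorem stub_stackingLock :
    ∀ (a h : ℝ) (s : ℤ → ℤ) (A : EuclideanSpace ℝ (Fin 3) ≃ₗᵢ[ℝ] EuclideanSpace ℝ (Fin 3))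
      (v : EuclideanSpace ℝ (Fin 3)),
      47 / 50 ≤ a → a ≤ 1 → 39 / 50 * a ≤ h → h ≤ 17 / 20 * a → IsHaggSeq s →
      (∀ p ∈ (fun z => A z + v) '' barlowStacking a h s,
        ∑' q : {q : EuclideanSpace ℝ (Fin 3) //
            q ∈ (fun z => A z + v) '' barlowStacking a h s ∧ q ≠ p},
          lennardJones (dist p q.1) ≤
        2 * ⨅ Q : PeriodicConfiguration 3, Q.energyPerParticle lennardJones) →
      ∀ m : ℤ, s (m + 1) = -s m := by
  intro a h s A v ha ha1 hh hh1 hs hU m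
  have ha0 : 0 < a := by linarith
  have hh0 : 0 < h := by linarith
  -- the site `p = A (barlowPos a h s m 0 0) + v ∈ X`
  have hp : A (barlowPos a h s m 0 0) + v ∈ (fun z => A z + v) '' barlowStacking a h s :=
    ⟨barlowPos a h s m 0 0, barlowPos_mem _ _ _, rfl⟩
  have h1 := hU _ hp
  rw [site_tsum_translate_eq ha0 hh0 s A v m] at h1
  -- `2E* ≤ 2 hcpE a h`
  have h2 := iInf_le_hcpE ha0 hh0
  have hsite : barlowSiteEnergy lennardJones a h s m ≤ hcpE a h := by linarith
  -- the site-energy column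
  obtain ⟨hgap, hcol⟩ := PalmGoodLaw.SiteColumnLJ.stub_siteColumnLJ a h ha ha1 hh hh1
  have hc := hcol s hs m
  have hne : ¬ s (m + 1) = s m := by
    intro heq
    rw [if_pos heq] at hc
    split_ifs at hc <;> linarith
  rcases hs m with h0 | h0 <;> rcases hs (m + 1) with h0' | h0' <;> omega

end Summit.AtomisticToContinuum.Crystallization.Theorems.PerronTransitivityUniformBindingRigidity

end
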